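import Literature.NumberTheory.EllipticCurves.Sprung2017.HalfLogarithmMatrixInvolutionOffDiagLowerProofs
import Summits.BirchSwinnertonDyer.BirchSwinnertonDyer.Theorems.SignedLowerHalvesSprungLowerDivisibilityAtThreeIotaOrderParity
import HarnessLib

/-!
# Crux `SprungLowerDivisibilityAtThree` (K1, item stmt-BirchSwinnertonDyer-19875), line `chromatic-common-zeros`:
# the SYMMETRIC order dichotomy — `|ord_T L♯ − ord_T L♭| ≤ 1`, `{ord_T L♯, ord_T L♭} = {r, r}` or `{r, r+1}` with
# `(−1)^r = σ = w(E)` — and «`L♭` from `L♯`» off the zeros of `g` (X8, class-wide, input-free)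

Cell `bsd-ssimc` (host), width seat `cruxlead-stmt-BirchSwinnertonDyer-19875-w3` (gen 5) under the 19875 lead; `--supports`
19875 `--as helper`; theorems only; closes NO item (skeleton v8 unchanged). K1, BSD and leaf X8 are NOT proved by anything
here. Sequel of `…IotaPairFESign` (p643456) / `…IotaOrderParity` (p643995), fed by the Literature companion
`HalfLogarithmMatrixInvolutionOffDiagLowerProofs` (uniqueness of the transition matrix; `M₁₀ = 3T·g`, `g(0) ≠ 0` for `3 ∤ b`).

## What is proved

* **`ClassX8.exists_pair_functionalEquation_both`** — the pair functional equation with `κ′(0) = σ`, `M₀₁ = 3T·u` (`u` unit)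
  AND `M₁₀ = 3T·g` with `g(0) ≠ 0`;
* **`ClassX8.order_dichotomy_sharp`** (the ♯-row read at the lowest `T`-power): `ord_T L♯ ≤ ord_T L♭ + 1`;
  `(−1)^{ord_T L♯} = −σ ⟹ ord_T L♭ + 1 = ord_T L♯`; `(−1)^{ord_T L♯} = σ ⟹ ord_T L♯ ≤ ord_T L♭`;
* **`ClassX8.order_trichotomy`** — with `…IotaOrderParity`: the pair `(ord_T L♯, ord_T L♭)` is `(r, r)`, `(r, r+1)` or
  `(r+1, r)` with `(−1)^r = σ`; in particular **`|ord_T L♯ − ord_T L♭| ≤ 1`** (`ClassX8.order_le_order_add_one`); at the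
  conductor level `(−1)^r = w(E)` (`ClassX8.order_trichotomy_rootNumber`);
* **`ClassX8.exists_flat_mem_of_sharp_iotaPair`** — there is `g ∈ Λ` with `g(0) ≠ 0` (depending on the pair) such that for
  every prime `𝔭 ∌ 3, T, g`: `L♯, L♯(T^ι) ∈ 𝔭 ⟹ L♭ ∈ 𝔭` (the ♯-colour analogue of p642065's
  `sharp_mem_of_flat_mem_of_subst_flat_mem`, valid off the zeros of `g`).

Relation to print: [DS19] Thm. 4.1 (completed pair: equal parities). For the non-completed pair the orders may differ by ONE,
never more, and the smaller one carries the parity of the root number.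

References: [DionSprung2019] Thm. 4.1, Cor. 4.7; [Sprung2017] Thm. 4.13, Cor. 4.14, Prop. 3.14, Cor. 4.6; [MazurTateTeitelbaum1986Invent]
§I.17; [GreenbergLNM1716] §1 and §5; [BernardiPerrinRiou1993] (context).
-/

set_option linter.dupNamespace false
set_option autoImplicit false

noncomputable section

open scoped Classical MatrixGroups ModularForm

open CongruenceSubgroup WeierstrassCurve Polynomial
  Literature.NumberTheory.EllipticCurves Literature.NumberTheory.EllipticCurves.ModularForms
  Literature.NumberTheory.EllipticCurves.Sprung2017 Literature.NumberTheory.EllipticCurves.Rank1Residual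
  Literature.Barriers.BirchSwinnertonDyer Summit.BirchSwinnertonDyer.Rank1Residual.Supersingular
  Summit.BirchSwinnertonDyer.BirchSwinnertonDyer.Theorems.ChromaticBothColours

namespace Summit.BirchSwinnertonDyer.BirchSwinnertonDyer.Theorems.ChromaticIota

/-! ## §1 X8: the pair functional equation with both off-diagonal invariants -/

section X8


/-- `ι ∘ ι = id` on `ℚ_3⟦T⟧` (private plumbing). [folklore] -/
private theorem subst_subst_rat₆ (g : PowerSeries ℚ_[3]) :
    PowerSeries.subst (invOnePlusSubOne : PowerSeries ℚ_[3])
      (PowerSeries.subst (invOnePlusSubOne : PowerSeries ℚ_[3]) g) = g := by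
  have hι := hasSubst_invOnePlusSubOne (R := ℚ_[3])
  rw [PowerSeries.subst_comp_subst_apply hι hι, invOnePlusSubOne_subst_self, PowerSeries.X_subst]

/-- `det ℒ(0) = 1/9 ≠ 0` (private plumbing). [cite: Sprung2017, §3.1 (ℒ(0) = C⁻²)] -/
private theorem det_halfLogMatrix_ne_zero₆ (b : ℤ) :
    halfLogMatrix b 0 0 * halfLogMatrix b 1 1 - halfLogMatrix b 0 1 * halfLogMatrix b 1 0 ≠ 0 := by
  intro h
  have h0 := congrArg PowerSeries.constantCoeff h
  rw [map_sub, map_mul, map_mul, constantCoeff_halfLogMatrix, constantCoeff_halfLogMatrix,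
    constantCoeff_halfLogMatrix, constantCoeff_halfLogMatrix, map_zero] at h0
  have hdetQ : (sprungCinv 3 (3 * b) ^ 2).det = 1 / 9 := by
    rw [Matrix.det_pow, Matrix.det_fin_two]
    simp [sprungCinv]
    norm_num
  have hcast : (((sprungCinv 3 (3 * b) ^ 2).det : ℚ) : ℚ_[3]) = 0 := by
    rw [Matrix.det_fin_two]
    push_cast
    linear_combination h0
  rw [hdetQ] at hcast
  norm_num at hcast

/-- **THE PAIR FUNCTIONAL EQUATION WITH BOTH OFF-DIAGONAL INVARIANTS.** For every X8 pair `(W, 3)`, newform `f` with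
`f|W_N = −σf` (`σ = ±1`), Sprung pair `(L♯, L♭)`: there are `κ′, u, m₀₀, g, m₁₁ ∈ Λ` with `κ′(0) = σ`, `u ∈ Λˣ`,
**`g(0) ≠ 0`**, `m₀₀(0) = m₁₁(0) = 1` and `κ′·L♯(T^ι) = m₀₀·L♯ + C(3)·T·g·L♭`, `κ′·L♭(T^ι) = C(3)·T·u·L♯ + m₁₁·L♭`.
As `ClassX8.exists_pair_functionalEquation_sign` (p643456), with `ord_T g = 0` from the uniqueness of the transition matrix and
`[T¹]M₁₀ ≡ 108b (mod 243)`. [cite: Sprung2017, Thm. 1.1, Thm. 4.13, Cor. 4.14, Prop. 3.14, Cor. 4.4 and Cor. 4.6]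
[cite: MazurTateTeitelbaum1986Invent, §I.17] [cite: GreenbergLNM1716, §1] -/
theorem ClassX8.exists_pair_functionalEquation_both (W : WeierstrassCurve ℚ) [W.IsElliptic] [W.IsGloballyMinimal]
    (p : ℕ) [Fact p.Prime] (hX : ClassX8 W p) {N : ℕ} [hN : NeZero N] (f : CuspForm (Gamma0 N) 2)
    (hf : IsNewformOf W f) {σ : ℤ} (hσ : σ = 1 ∨ σ = -1) (hW : IsFrickeEigen N f (-(σ : ℂ)))
    (Lsharp Lflat : IwasawaAlgebra p) (hSP : IsSprungPair f p (W.frobeniusTrace p) Lsharp Lflat) :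
    ∃ κ' u m₀₀ g m₁₁ : IwasawaAlgebra p, PowerSeries.constantCoeff κ' = σ ∧ IsUnit u ∧
      PowerSeries.constantCoeff g ≠ 0 ∧
      PowerSeries.constantCoeff m₀₀ = 1 ∧ PowerSeries.constantCoeff m₁₁ = 1 ∧
      κ' * PowerSeries.subst (invOnePlusSubOne : IwasawaAlgebra p) Lsharp =
        m₀₀ * Lsharp + PowerSeries.C (p : ℤ_[p]) * PowerSeries.X * g * Lflat ∧
      κ' * PowerSeries.subst (invOnePlusSubOne : IwasawaAlgebra p) Lflat =
        PowerSeries.C (p : ℤ_[p]) * PowerSeries.X * u * Lsharp + m₁₁ * Lflat := by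
  obtain ⟨hp3, ⟨hgood, -⟩, -⟩ := id hX
  subst hp3
  haveI : NeZero N := hN
  have hσ2 : σ ^ 2 = 1 := by rcases hσ with rfl | rfl <;> norm_num
  -- `a_3 = 3b`, `b = ±1`, so `3 ∤ b`
  obtain ⟨b, hb, hab⟩ : ∃ b : ℤ, (b = 1 ∨ b = -1) ∧ W.frobeniusTrace 3 = 3 * b := by
    rcases ClassX8.frobeniusTrace_eq_three_or W 3 hX with h | h
    · exact ⟨1, Or.inl rfl, by rw [h]; norm_num⟩
    · exact ⟨-1, Or.inr rfl, by rw [h]; norm_num⟩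
  have hb3 : ¬ (3 : ℤ) ∣ b := by rcases hb with rfl | rfl <;> decide
  rw [hab] at hSP
  -- the Teichmüller exponent of the level (`3 ∤ N`)
  have hpN : ¬ 3 ∣ N := not_dvd_level_of_isNewformOf hf hgood
  obtain ⟨ηN, c, hc⟩ := exists_teichmuller_exponent_natCast (p := 3) hpN
  -- the functional equation of the trace coordinates (PROVED fact) and the refined integral transition matrix
  have hFE := thm413_traceCoordinate_functionalEquation_three_holds W N f b hb hf hgood hab σ hσ2 hW ηN c hc
    invOnePlusSubOne one_add_X_mul_invOnePlusSubOne_add_one Lsharp Lflat hSP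
  obtain ⟨M, ⟨u, hu, hM01⟩, ⟨g, hg0, hM10⟩, hM00, hM11, hM⟩ :=
    exists_integral_halfLogMatrix_offDiag_both b hb3
  -- cancelling `ℒ` in `ℚ_3⟦T⟧`
  have hι := hasSubst_invOnePlusSubOne (R := ℚ_[3])
  set τ : PowerSeries ℚ_[3] →+* PowerSeries ℚ_[3] := (PowerSeries.substAlgHom hι).toRingHom with hτ
  have hτapp : ∀ x : PowerSeries ℚ_[3], τ x = PowerSeries.subst (invOnePlusSubOne : PowerSeries ℚ_[3]) x :=
    fun x => by rw [hτ, AlgHom.toRingHom_eq_coe, RingHom.coe_coe, PowerSeries.coe_substAlgHom]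
  have hττ : ∀ x, τ (τ x) = x := fun x => by rw [hτapp, hτapp, subst_subst_rat₆]
  set κ : PowerSeries ℚ_[3] :=
    (σ : PowerSeries ℚ_[3]) * (PowerSeries.binomialSeries ℤ_[3] c).map (algebraMap ℤ_[3] ℚ_[3]) with hκ
  set L : Fin 2 → PowerSeries ℚ_[3] := ![iwasawaToPowerSeries 3 Lsharp, iwasawaToPowerSeries 3 Lflat] with hL
  have hL0 : L 0 = iwasawaToPowerSeries 3 Lsharp := rfl
  have hL1 : L 1 = iwasawaToPowerSeries 3 Lflat := rfl
  have hFE' : ∀ k : Fin 2, τ (L 0 * halfLogMatrix b 0 k + L 1 * halfLogMatrix b 1 k) =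
      κ * (L 0 * halfLogMatrix b 0 k + L 1 * halfLogMatrix b 1 k) := by
    intro k
    rw [hτapp, hL0, hL1]
    exact hFE k
  have hM' : ∀ i k : Fin 2, halfLogMatrix b i k =
      (M.map (iwasawaToPowerSeries 3)) i 0 * τ (halfLogMatrix b 0 k) +
        (M.map (iwasawaToPowerSeries 3)) i 1 * τ (halfLogMatrix b 1 k) := by
    intro i k
    rw [Matrix.map_apply, Matrix.map_apply, hτapp, hτapp]
    exact hM i k
  have key := mul_map_eq_of_traceFE τ hττ L (halfLogMatrix b) (M.map (iwasawaToPowerSeries 3)) κ hFE' hM'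
    (det_halfLogMatrix_ne_zero₆ b)
  -- pull back to `Λ`
  set κΛ : IwasawaAlgebra 3 := (σ : IwasawaAlgebra 3) * PowerSeries.binomialSeries ℤ_[3] c with hκΛ
  have hκι : κ = iwasawaToPowerSeries 3 κΛ := by rw [hκ, hκΛ, map_mul, map_intCast]
  have hκ0 : PowerSeries.constantCoeff (PowerSeries.subst (invOnePlusSubOne : IwasawaAlgebra 3) κΛ) = σ := by
    rw [Literature.Barriers.BirchSwinnertonDyer.constantCoeff_subst_of_constantCoeff_eq_zero
      constantCoeff_invOnePlusSubOne, hκΛ, map_mul, map_intCast,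
      PowerSeries.binomialSeries_constantCoeff, mul_one]
  have hpull : ∀ (Ll : IwasawaAlgebra 3) (m0 m1 : IwasawaAlgebra 3),
      τ κ * τ (iwasawaToPowerSeries 3 Ll) = iwasawaToPowerSeries 3 Lsharp * iwasawaToPowerSeries 3 m0 +
        iwasawaToPowerSeries 3 Lflat * iwasawaToPowerSeries 3 m1 →
      PowerSeries.subst (invOnePlusSubOne : IwasawaAlgebra 3) κΛ *
          PowerSeries.subst (invOnePlusSubOne : IwasawaAlgebra 3) Ll = Lsharp * m0 + Lflat * m1 := by
    intro Ll m0 m1 h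
    apply iwasawaToPowerSeries_injective 3
    rw [map_mul, map_add, map_mul, map_mul, iwasawaToPowerSeries_subst_invOnePlusSubOne,
      iwasawaToPowerSeries_subst_invOnePlusSubOne, ← hκι, ← hτapp, ← hτapp]
    exact h
  have hs : PowerSeries.subst (invOnePlusSubOne : IwasawaAlgebra 3) κΛ *
      PowerSeries.subst (invOnePlusSubOne : IwasawaAlgebra 3) Lsharp = Lsharp * M 0 0 + Lflat * M 1 0 := by
    apply hpull
    have h := key 0
    rw [hL0, hL1, Matrix.map_apply, Matrix.map_apply] at h
    simpa using h
  have hfl : PowerSeries.subst (invOnePlusSubOne : IwasawaAlgebra 3) κΛ *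
      PowerSeries.subst (invOnePlusSubOne : IwasawaAlgebra 3) Lflat = Lsharp * M 0 1 + Lflat * M 1 1 := by
    apply hpull
    have h := key 1
    rw [hL0, hL1, Matrix.map_apply, Matrix.map_apply] at h
    simpa using h
  refine ⟨PowerSeries.subst (invOnePlusSubOne : IwasawaAlgebra 3) κΛ, u, M 0 0, g, M 1 1, hκ0, hu, hg0, hM00, hM11,
    ?_, ?_⟩
  · rw [hs, hM10]
    push_cast
    ring
  · rw [hfl, hM01]
    push_cast
    ring


/-! ## §2 X8: the ♯-row at the lowest `T`-power and the symmetric dichotomy -/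

/-- `ord_T (C(p)·g·L) = ord_T L` when `g(0) ≠ 0` (private plumbing). [folklore] -/
private theorem order_C_mul_mul_of_constantCoeff_ne_zero {p : ℕ} [hp : Fact p.Prime] {g L : IwasawaAlgebra p}
    (hg : PowerSeries.constantCoeff g ≠ 0) : (PowerSeries.C (p : ℤ_[p]) * g * L).order = L.order := by
  have hC : (PowerSeries.C (p : ℤ_[p]) : IwasawaAlgebra p).order = 0 := by
    refine PowerSeries.order_eq_nat.mpr ⟨?_, fun i hi => absurd hi (Nat.not_lt_zero i)⟩
    rw [PowerSeries.coeff_zero_eq_constantCoeff_apply, PowerSeries.constantCoeff_C]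
    exact_mod_cast hp.out.ne_zero
  have hg0 : g.order = 0 := by
    refine PowerSeries.order_eq_nat.mpr ⟨?_, fun i hi => absurd hi (Nat.not_lt_zero i)⟩
    rwa [PowerSeries.coeff_zero_eq_constantCoeff_apply]
  rw [PowerSeries.order_mul, PowerSeries.order_mul, hC, hg0, zero_add, zero_add]

/-- **ORDER DICHOTOMY FROM THE ♯-ROW (X8, class-wide, input-free).** For every X8 pair, newform `f` with `f|W_N = −σf`,
Sprung pair with `ord_T L♯ = r♯`, `ord_T L♭ = r♭`: `r♯ ≤ r♭ + 1`; if `(−1)^{r♯} = −σ` then `r♭ + 1 = r♯`; if `(−1)^{r♯} = σ`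
then `r♯ ≤ r♭`. [cite: Sprung2017, Thm. 4.13, Cor. 4.14, Prop. 3.14 and Cor. 4.6] [cite: DionSprung2019, Thm. 4.1 (completed
pair)] [cite: GreenbergLNM1716, §1] -/
theorem ClassX8.order_dichotomy_sharp (W : WeierstrassCurve ℚ) [W.IsElliptic] [W.IsGloballyMinimal] (p : ℕ)
    [Fact p.Prime] (hX : ClassX8 W p) {N : ℕ} [hN : NeZero N] (f : CuspForm (Gamma0 N) 2) (hf : IsNewformOf W f)
    {σ : ℤ} (hσ : σ = 1 ∨ σ = -1) (hW : IsFrickeEigen N f (-(σ : ℂ))) (Lsharp Lflat : IwasawaAlgebra p)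
    (hSP : IsSprungPair f p (W.frobeniusTrace p) Lsharp Lflat) {rs rf : ℕ} (hrs : Lsharp.order = rs)
    (hrf : Lflat.order = rf) :
    rs ≤ rf + 1 ∧ ((-1 : ℤ) ^ rs = -σ → rf + 1 = rs) ∧ ((-1 : ℤ) ^ rs = σ → rs ≤ rf) := by
  obtain ⟨κ', -, m₀₀, g, -, hκ', -, hg0, hm₀₀, -, hs, -⟩ :=
    ClassX8.exists_pair_functionalEquation_both W p hX f hf hσ hW Lsharp Lflat hSP
  -- `X · (C(p)·g·L♭) = κ′·L♯(T^ι) − m₀₀·L♯`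
  have hFE : PowerSeries.X * (PowerSeries.C (p : ℤ_[p]) * g * Lflat) =
      κ' * PowerSeries.subst (invOnePlusSubOne : IwasawaAlgebra p) Lsharp - m₀₀ * Lsharp := by
    rw [hs]
    ring
  have hordH : (PowerSeries.C (p : ℤ_[p]) * g * Lflat).order = rf := by
    rw [order_C_mul_mul_of_constantCoeff_ne_zero hg0, hrf]
  have hodd : (-1 : ℤ) ^ rs = -σ → rf + 1 = rs := by
    intro hpar
    obtain ⟨n, hn, hordn⟩ := order_eq_pred_of_pairFE hrs hσ hκ' hm₀₀ hFE hpar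
    rw [hordH] at hordn
    have : rf = n := by exact_mod_cast hordn
    omega
  have heven : (-1 : ℤ) ^ rs = σ → rs ≤ rf := by
    intro hpar
    have h := le_order_of_pairFE hrs hκ' hm₀₀ hFE hpar
    rw [hordH] at h
    exact_mod_cast h
  refine ⟨?_, hodd, heven⟩
  rcases neg_one_pow_eq_or ℤ rs with h1 | h1
  · rcases hσ with rfl | rfl
    · exact (heven h1).trans (Nat.le_succ rf)
    · exact (hodd (by rw [h1]; norm_num)).symm.le
  · rcases hσ with rfl | rfl
    · exact (hodd h1).symm.le
    · exact (heven h1).trans (Nat.le_succ rf)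

/-- **`|ord_T L♯ − ord_T L♭| ≤ 1` ON X8** (class-wide, input-free): the orders of vanishing at `T = 0` of the two non-completed
colours differ by at most one. [cite: Sprung2017, Thm. 4.13 and Cor. 4.14] [cite: DionSprung2019, Thm. 4.1 (completed pair)]
[cite: BernardiPerrinRiou1993] -/
theorem ClassX8.order_le_order_add_one (W : WeierstrassCurve ℚ) [W.IsElliptic] [W.IsGloballyMinimal] (p : ℕ)
    [Fact p.Prime] (hX : ClassX8 W p) {N : ℕ} [hN : NeZero N] (f : CuspForm (Gamma0 N) 2) (hf : IsNewformOf W f)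
    (Lsharp Lflat : IwasawaAlgebra p) (hSP : IsSprungPair f p (W.frobeniusTrace p) Lsharp Lflat) {rs rf : ℕ}
    (hrs : Lsharp.order = rs) (hrf : Lflat.order = rf) : rs ≤ rf + 1 ∧ rf ≤ rs + 1 := by
  haveI : NeZero N := hN
  obtain ⟨σ, hσ, -, hW⟩ := exists_sign_isFrickeEigen hf
  exact ⟨(ClassX8.order_dichotomy_sharp W p hX f hf hσ hW Lsharp Lflat hSP hrs hrf).1,
    (ClassX8.order_dichotomy W p hX f hf hσ hW Lsharp Lflat hSP hrs hrf).1⟩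

/-- **ORDER TRICHOTOMY ON X8 (class-wide, input-free).** For every X8 pair, newform `f` with `f|W_N = −σf`, Sprung pair:
`(ord_T L♯, ord_T L♭)` is `(r, r)`, `(r, r+1)` or `(r+1, r)` with `(−1)^r = σ` — the smaller order has the parity of the
Fricke sign and the other exceeds it by at most one. [cite: Sprung2017, Thm. 4.13 and Cor. 4.14]
[cite: DionSprung2019, Thm. 4.1 (completed pair)] [cite: GreenbergLNM1716, §1] -/
theorem ClassX8.order_trichotomy (W : WeierstrassCurve ℚ) [W.IsElliptic] [W.IsGloballyMinimal] (p : ℕ)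
    [Fact p.Prime] (hX : ClassX8 W p) {N : ℕ} [hN : NeZero N] (f : CuspForm (Gamma0 N) 2) (hf : IsNewformOf W f)
    {σ : ℤ} (hσ : σ = 1 ∨ σ = -1) (hW : IsFrickeEigen N f (-(σ : ℂ))) (Lsharp Lflat : IwasawaAlgebra p)
    (hSP : IsSprungPair f p (W.frobeniusTrace p) Lsharp Lflat) {rs rf : ℕ} (hrs : Lsharp.order = rs)
    (hrf : Lflat.order = rf) :
    (rs = rf ∧ (-1 : ℤ) ^ rs = σ) ∨ (rf = rs + 1 ∧ (-1 : ℤ) ^ rs = σ) ∨ (rs = rf + 1 ∧ (-1 : ℤ) ^ rf = σ) := by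
  obtain ⟨hle1, hodd1, heven1⟩ := ClassX8.order_dichotomy W p hX f hf hσ hW Lsharp Lflat hSP hrs hrf
  obtain ⟨hle2, hodd2, heven2⟩ := ClassX8.order_dichotomy_sharp W p hX f hf hσ hW Lsharp Lflat hSP hrs hrf
  have hmin := ClassX8.neg_one_pow_min_order_eq_frickeSign W p hX f hf hσ hW Lsharp Lflat hSP hrs hrf
  rcases Nat.lt_trichotomy rs rf with h | h | h
  · right; left
    refine ⟨by omega, ?_⟩
    rwa [min_eq_left h.le] at hmin
  · left
    refine ⟨h, ?_⟩
    rw [h, min_self] at hmin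
    rwa [h]
  · right; right
    refine ⟨by omega, ?_⟩
    rwa [min_eq_right h.le] at hmin

/-- **Order trichotomy at the conductor level** (`σ = w(E)`): `(ord_T L♯, ord_T L♭) ∈ {(r, r), (r, r+1), (r+1, r)}` with
`(−1)^r = w(E)`. [cite: Sprung2017, Thm. 4.13 and Cor. 4.14] [cite: DionSprung2019, Thm. 4.1 (completed pair)]
[cite: GreenbergLNM1716, §1 (p. 68, `w_E`)] -/
theorem ClassX8.order_trichotomy_rootNumber (W : WeierstrassCurve ℚ) [W.IsElliptic] [W.IsGloballyMinimal]
    [NeZero (W.conductorNorm ℤ)] (p : ℕ) [Fact p.Prime] (hX : ClassX8 W p)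
    (f : CuspForm (Gamma0 (W.conductorNorm ℤ)) 2) (hf : IsNewformOf W f) (Lsharp Lflat : IwasawaAlgebra p)
    (hSP : IsSprungPair f p (W.frobeniusTrace p) Lsharp Lflat) {rs rf : ℕ} (hrs : Lsharp.order = rs)
    (hrf : Lflat.order = rf) :
    (rs = rf ∧ (-1 : ℤ) ^ rs = W.rootNumber) ∨ (rf = rs + 1 ∧ (-1 : ℤ) ^ rs = W.rootNumber) ∨
      (rs = rf + 1 ∧ (-1 : ℤ) ^ rf = W.rootNumber) :=
  ClassX8.order_trichotomy W p hX f hf W.rootNumber_eq_one_or (isFrickeEigen_neg_rootNumber hf) Lsharp Lflat hSP hrs hrf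

/-! ## §3 X8: «`L♭` from `L♯`» off the zeros of `g` -/

/-- **ι-PAIRED ZEROS OF `L♯` ARE COMMON ZEROS, off the zeros of `g`.** For every X8 pair, newform and Sprung pair there is
`g ∈ Λ` with `g(0) ≠ 0` such that for every prime `𝔭 ⊂ Λ` with `3, T, g ∉ 𝔭`: `L♯ ∈ 𝔭` and `L♯(T^ι) ∈ 𝔭` imply `L♭ ∈ 𝔭`
(the ♯-row `κ′·L♯(T^ι) − m₀₀·L♯ = C(3)·T·g·L♭`). [cite: Sprung2017, Thm. 4.13, Cor. 4.14, Prop. 3.14 and Cor. 4.6]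
[cite: GreenbergLNM1716, §1 and §5] -/
theorem ClassX8.exists_flat_mem_of_sharp_iotaPair (W : WeierstrassCurve ℚ) [W.IsElliptic] [W.IsGloballyMinimal]
    (p : ℕ) [Fact p.Prime] (hX : ClassX8 W p) {N : ℕ} [hN : NeZero N] (f : CuspForm (Gamma0 N) 2)
    (hf : IsNewformOf W f) (Lsharp Lflat : IwasawaAlgebra p)
    (hSP : IsSprungPair f p (W.frobeniusTrace p) Lsharp Lflat) :
    ∃ g : IwasawaAlgebra p, PowerSeries.constantCoeff g ≠ 0 ∧
      ∀ 𝔭 : Ideal (IwasawaAlgebra p), 𝔭.IsPrime → (p : IwasawaAlgebra p) ∉ 𝔭 →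
        (PowerSeries.X : IwasawaAlgebra p) ∉ 𝔭 → g ∉ 𝔭 → Lsharp ∈ 𝔭 →
        PowerSeries.subst (invOnePlusSubOne : IwasawaAlgebra p) Lsharp ∈ 𝔭 → Lflat ∈ 𝔭 := by
  haveI : NeZero N := hN
  obtain ⟨σ, hσ, -, hW⟩ := exists_sign_isFrickeEigen hf
  obtain ⟨κ', -, m₀₀, g, -, -, -, hg0, -, -, hs, -⟩ :=
    ClassX8.exists_pair_functionalEquation_both W p hX f hf hσ hW Lsharp Lflat hSP
  refine ⟨g, hg0, fun 𝔭 h𝔭 hp𝔭 hT hg𝔭 hsh hshι => ?_⟩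
  have hmem : PowerSeries.C (p : ℤ_[p]) * PowerSeries.X * g * Lflat ∈ 𝔭 := by
    have : PowerSeries.C (p : ℤ_[p]) * PowerSeries.X * g * Lflat =
        κ' * PowerSeries.subst (invOnePlusSubOne : IwasawaAlgebra p) Lsharp - m₀₀ * Lsharp := by
      rw [hs]
      ring
    rw [this]
    exact 𝔭.sub_mem (𝔭.mul_mem_left _ hshι) (𝔭.mul_mem_left _ hsh)
  rcases h𝔭.mem_or_mem hmem with h1 | hF
  · rcases h𝔭.mem_or_mem h1 with h2 | hg'
    · rcases h𝔭.mem_or_mem h2 with hC | hX'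
      · rw [map_natCast] at hC
        exact absurd hC hp𝔭
      · exact absurd hX' hT
    · exact absurd hg' hg𝔭
  · exact hF

end X8

end Summit.BirchSwinnertonDyer.BirchSwinnertonDyer.Theorems.ChromaticIota

end
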